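import Mathlib
import Summits.NavierStokesRegularity.NavierStokesRegularity.Theorems.EulerZoomLiouvillePowerGaugeEulerLiouvilleHoopBoxAssembly
import Summits.NavierStokesRegularity.NavierStokesRegularity.Theorems.EulerZoomLiouvillePowerGaugeEulerLiouvilleHoopLateralSlice

/-!
# LEL-3a: THE BOX INEQUALITY WITH THE WALL TERM, chart-free (LEAD 19832 g15; nsreg-p2 ROUND-50 t53-LEL, third file, part a)

Helper for crux `EulerZoomLiouville.PowerGaugeEulerLiouville` (stmt-NavierStokesRegularity-19832), LEAD ns-typeII-p2 g15,
`--supports stmt-NavierStokesRegularity-19832 --as helper`.  The chart-free box form of nsreg-p2 g40's ROUND-50 §1 LATERAL HOOP INEQUALITY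
(`r50/Sketch50.lean` 6c31f8f6e879902e): ns-ezl-w2 g5's `hoop_slice_le_frame` (hoop part of one slice, carrying `−E_σ(T)`) PLUS the LEAD's LEL-2
`lateral_slice_le_frame` (wall part, carrying `+E_σ(T)`: the sinuous wall energy CANCELS — «the wall comes for free»), then the `σ`-integration, the
`σ`-integration by parts of the `∂_zV_z` pairing (`pairing_sigma_ftc`), the cross-term and end-disc bounds — verbatim the steps of `hoop_box_le`
(ns-ezl-w2 g5, `…HoopBoxAssembly`).  The chart instantiation and the R50 text are in `…HoopLateral` (LEL-3b).

* `lateral_box_le` — `∫σ∫₀^T t⁻¹∫_θ(a² − b²) + ∫σ∫_θ a(σ,T,θ)² ≤ ∫σ∫₀^T t∫_θ(mr² + mθ² + aσ² + mz²) + ∫σ∫₀^T t∫_θ(mr² + mθ² + ad²) + ∫σ E_σ(0)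
  + ∫₀^T∫_θ(a² + c²)(s₁) + ∫₀^T∫_θ(a² + c²)(s₂)`.

HONEST FRAMING: calculus on abstract slice data; it proves nothing about the crux E (19832 OPEN), Euler profiles or Navier–Stokes regularity.
[nsreg-p2 ROUND-50 §1; ns-idea-11 HOOP-NOTE §10(a); folklore]
-/

noncomputable section

open MeasureTheory Set Metric Real Function Filter Topology
open scoped Interval

set_option linter.dupNamespace false

namespace Summit.NavierStokesRegularity.NavierStokesRegularity.Theorems.PowerGaugeEulerLiouville.HoopCore

/-- **THE BOX INEQUALITY WITH THE WALL TERM** (chart-free).  Data as in ns-ezl-w2 g5's `hoop_box_le` plus the first-mode axis trace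
`a σ 0 θ = v₀ σ cos θ + v₁ σ sin θ`.  Then
`∫σ∫₀^T t⁻¹∫_θ(a² − b²) + ∫σ∫_θ a(σ,T,θ)² ≤ ∫σ∫₀^T t∫_θ(mr² + mθ² + aσ² + mz²) + ∫σ∫₀^T t∫_θ(mr² + mθ² + ad²) + ∫σ E_σ(0)
   + ∫₀^T∫_θ(a² + c²)(s₁) + ∫₀^T∫_θ(a² + c²)(s₂)`.  [nsreg-p2 ROUND-50 §1; folklore] -/
theorem lateral_box_le {a b c ad aσ cσ mr mθ mz : ℝ → ℝ → ℝ → ℝ} {v₀ v₁ : ℝ → ℝ} {s₁ s₂ T M : ℝ} (hs : s₁ ≤ s₂) (hT : 0 < T)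
    (haθ : ∀ σ t θ, HasDerivAt (fun θ => a σ t θ) (t * mr σ t θ + b σ t θ) θ)
    (hbθ : ∀ σ t θ, HasDerivAt (fun θ => b σ t θ) (t * mθ σ t θ - a σ t θ) θ)
    (hcθ : ∀ σ t θ, HasDerivAt (fun θ => c σ t θ) (t * mz σ t θ) θ)
    (had : ∀ σ t θ, HasDerivAt (fun t => a σ t θ) (ad σ t θ) t)
    (haσ : ∀ σ t θ, HasDerivAt (fun σ => a σ t θ) (aσ σ t θ) σ)
    (hcσ : ∀ σ t θ, HasDerivAt (fun σ => c σ t θ) (cσ σ t θ) σ)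
    (hac : Continuous fun q : ℝ × ℝ × ℝ => a q.1 q.2.1 q.2.2) (hbc : Continuous fun q : ℝ × ℝ × ℝ => b q.1 q.2.1 q.2.2)
    (hcc : Continuous fun q : ℝ × ℝ × ℝ => c q.1 q.2.1 q.2.2) (hadc : Continuous fun q : ℝ × ℝ × ℝ => ad q.1 q.2.1 q.2.2)
    (haσc : Continuous fun q : ℝ × ℝ × ℝ => aσ q.1 q.2.1 q.2.2) (hcσc : Continuous fun q : ℝ × ℝ × ℝ => cσ q.1 q.2.1 q.2.2)
    (hmrc : Continuous fun q : ℝ × ℝ × ℝ => mr q.1 q.2.1 q.2.2) (hmθc : Continuous fun q : ℝ × ℝ × ℝ => mθ q.1 q.2.1 q.2.2)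
    (hmzc : Continuous fun q : ℝ × ℝ × ℝ => mz q.1 q.2.1 q.2.2)
    (haper : ∀ σ t, a σ t (2 * π) = a σ t 0) (hbper : ∀ σ t, b σ t (2 * π) = b σ t 0)
    (hcper : ∀ σ t, c σ t (2 * π) = c σ t 0)
    (hdiv : ∀ σ t θ, ad σ t θ + mθ σ t θ + cσ σ t θ = 0)
    (ha0 : ∀ σ θ, a σ 0 θ = v₀ σ * Real.cos θ + v₁ σ * Real.sin θ)
    (hM : ∀ σ ∈ Icc s₁ s₂, ∀ t ∈ Ioc 0 T, |t⁻¹ * ∫ θ in (0 : ℝ)..2 * π, (a σ t θ ^ 2 - b σ t θ ^ 2)| ≤ M) :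
    (∫ σ in s₁..s₂, ∫ t in (0 : ℝ)..T, t⁻¹ * ∫ θ in (0 : ℝ)..2 * π, (a σ t θ ^ 2 - b σ t θ ^ 2)) +
        (∫ σ in s₁..s₂, ∫ θ in (0 : ℝ)..2 * π, a σ T θ ^ 2) ≤
      (∫ σ in s₁..s₂, ∫ t in (0 : ℝ)..T, t * ∫ θ in (0 : ℝ)..2 * π,
          (mr σ t θ ^ 2 + mθ σ t θ ^ 2 + aσ σ t θ ^ 2 + mz σ t θ ^ 2))
        + (∫ σ in s₁..s₂, ∫ t in (0 : ℝ)..T, t * ∫ θ in (0 : ℝ)..2 * π,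
          (mr σ t θ ^ 2 + mθ σ t θ ^ 2 + ad σ t θ ^ 2))
        + (∫ σ in s₁..s₂, π⁻¹ * ((∫ y in (0 : ℝ)..2 * π, a σ 0 y * Real.cos y) ^ 2
            + (∫ y in (0 : ℝ)..2 * π, a σ 0 y * Real.sin y) ^ 2))
        + (∫ t in (0 : ℝ)..T, ∫ θ in (0 : ℝ)..2 * π, (a s₁ t θ ^ 2 + c s₁ t θ ^ 2))
        + (∫ t in (0 : ℝ)..T, ∫ θ in (0 : ℝ)..2 * π, (a s₂ t θ ^ 2 + c s₂ t θ ^ 2)) := by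
  -- ### bookkeeping: sections and coefficient functions are continuous
  have sec2 : ∀ {f : ℝ → ℝ → ℝ → ℝ}, (Continuous fun q : ℝ × ℝ × ℝ => f q.1 q.2.1 q.2.2) → ∀ σ, Continuous (uncurry (f σ)) :=
    fun hf σ => hf.comp (continuous_const.prodMk continuous_id)
  have sec1 : ∀ {f : ℝ → ℝ → ℝ → ℝ}, (Continuous fun q : ℝ × ℝ × ℝ => f q.1 q.2.1 q.2.2) → ∀ σ t, Continuous (f σ t) :=
    fun hf σ t => hf.comp (continuous_const.prodMk (continuous_const.prodMk continuous_id))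
  have hCa := continuous_coeff₂ hac continuous_cos
  have hSa := continuous_coeff₂ hac continuous_sin
  have hCc := continuous_coeff₂ hcc continuous_cos
  have hSc := continuous_coeff₂ hcc continuous_sin
  have hCaσ := continuous_coeff₂ haσc continuous_cos
  have hSaσ := continuous_coeff₂ haσc continuous_sin
  have hCcσ := continuous_coeff₂ hcσc continuous_cos
  have hScσ := continuous_coeff₂ hcσc continuous_sin
  -- the `θ`-integrals of squares, jointly continuous in `(σ, t)`
  have hG : Continuous fun p : ℝ × ℝ => ∫ θ in (0 : ℝ)..2 * π, (a p.1 p.2 θ ^ 2 - b p.1 p.2 θ ^ 2) :=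
    continuous_parametric₂_intervalIntegral (F := fun σ t θ => a σ t θ ^ 2 - b σ t θ ^ 2)
      ((hac.pow 2).sub (hbc.pow 2)) _ _
  have hH : Continuous fun p : ℝ × ℝ => ∫ θ in (0 : ℝ)..2 * π, (mr p.1 p.2 θ ^ 2 + mθ p.1 p.2 θ ^ 2) :=
    continuous_parametric₂_intervalIntegral (F := fun σ t θ => mr σ t θ ^ 2 + mθ σ t θ ^ 2)
      ((hmrc.pow 2).add (hmθc.pow 2)) _ _
  have hH3 : Continuous fun p : ℝ × ℝ => ∫ θ in (0 : ℝ)..2 * π, (mr p.1 p.2 θ ^ 2 + mθ p.1 p.2 θ ^ 2 + ad p.1 p.2 θ ^ 2) :=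
    continuous_parametric₂_intervalIntegral (F := fun σ t θ => mr σ t θ ^ 2 + mθ σ t θ ^ 2 + ad σ t θ ^ 2)
      (((hmrc.pow 2).add (hmθc.pow 2)).add (hadc.pow 2)) _ _
  have hAD : Continuous fun p : ℝ × ℝ => ∫ θ in (0 : ℝ)..2 * π, ad p.1 p.2 θ ^ 2 :=
    continuous_parametric₂_intervalIntegral (F := fun σ t θ => ad σ t θ ^ 2) (hadc.pow 2) _ _
  have hA2 : Continuous fun p : ℝ × ℝ => ∫ θ in (0 : ℝ)..2 * π, a p.1 p.2 θ ^ 2 :=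
    continuous_parametric₂_intervalIntegral (F := fun σ t θ => a σ t θ ^ 2) (hac.pow 2) _ _
  have hX1 : Continuous fun p : ℝ × ℝ => ∫ θ in (0 : ℝ)..2 * π, aσ p.1 p.2 θ ^ 2 :=
    continuous_parametric₂_intervalIntegral (F := fun σ t θ => aσ σ t θ ^ 2) (haσc.pow 2) _ _
  have hX2 : Continuous fun p : ℝ × ℝ => ∫ θ in (0 : ℝ)..2 * π, mz p.1 p.2 θ ^ 2 :=
    continuous_parametric₂_intervalIntegral (F := fun σ t θ => mz σ t θ ^ 2) (hmzc.pow 2) _ _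
  have hAC : Continuous fun p : ℝ × ℝ => ∫ θ in (0 : ℝ)..2 * π, (a p.1 p.2 θ ^ 2 + c p.1 p.2 θ ^ 2) :=
    continuous_parametric₂_intervalIntegral (F := fun σ t θ => a σ t θ ^ 2 + c σ t θ ^ 2)
      ((hac.pow 2).add (hcc.pow 2)) _ _
  have hHc' : Continuous (uncurry fun σ t => t * ∫ θ in (0 : ℝ)..2 * π, (mr σ t θ ^ 2 + mθ σ t θ ^ 2)) :=
    continuous_snd.mul hH
  have hH3c' : Continuous (uncurry fun σ t => t * ∫ θ in (0 : ℝ)..2 * π, (mr σ t θ ^ 2 + mθ σ t θ ^ 2 + ad σ t θ ^ 2)) :=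
    continuous_snd.mul hH3
  have hADc' : Continuous (uncurry fun σ t => t * ∫ θ in (0 : ℝ)..2 * π, ad σ t θ ^ 2) := continuous_snd.mul hAD
  -- ### step 1: the combined slice inequality at every height `σ ∈ [s₁, s₂]` (the sinuous wall energy `E_σ(T)` cancels)
  have hslice : ∀ σ ∈ Icc s₁ s₂,
      (∫ t in (0 : ℝ)..T, t⁻¹ * ∫ θ in (0 : ℝ)..2 * π, (a σ t θ ^ 2 - b σ t θ ^ 2)) +
          (∫ θ in (0 : ℝ)..2 * π, a σ T θ ^ 2) ≤
        (∫ t in (0 : ℝ)..T, t * ∫ θ in (0 : ℝ)..2 * π, (mr σ t θ ^ 2 + mθ σ t θ ^ 2))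
          + (∫ t in (0 : ℝ)..T, t * ∫ θ in (0 : ℝ)..2 * π, (mr σ t θ ^ 2 + mθ σ t θ ^ 2 + ad σ t θ ^ 2))
          + π⁻¹ * ((∫ y in (0 : ℝ)..2 * π, a σ 0 y * Real.cos y) ^ 2
              + (∫ y in (0 : ℝ)..2 * π, a σ 0 y * Real.sin y) ^ 2)
          - 2 * ∫ t in (0 : ℝ)..T, ∫ θ in (0 : ℝ)..2 * π,
              (π⁻¹ * (∫ y in (0 : ℝ)..2 * π, a σ t y * Real.cos y) * Real.cos θ +
              π⁻¹ * (∫ y in (0 : ℝ)..2 * π, a σ t y * Real.sin y) * Real.sin θ) * cσ σ t θ := by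
    intro σ hσ
    have hint : IntervalIntegrable (fun t => t⁻¹ * ∫ θ in (0 : ℝ)..2 * π, (a σ t θ ^ 2 - b σ t θ ^ 2)) volume 0 T :=
      intervalIntegrable_inv_mul_of_bound (G := fun t => ∫ θ in (0 : ℝ)..2 * π, (a σ t θ ^ 2 - b σ t θ ^ 2))
        (hG.comp (continuous_const.prodMk continuous_id)) hT.le (hM σ hσ)
    have h1 := hoop_slice_le_frame hT (haθ σ) (hbθ σ) (had σ) (sec2 hac σ) (sec2 hbc σ) (sec2 hmrc σ) (sec2 hmθc σ)
      (sec2 hadc σ) (sec2 hcσc σ) (haper σ) (hbper σ) (hdiv σ) hint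
    have h2 := lateral_slice_le_frame hT (haθ σ) (hbθ σ) (had σ) (sec2 hac σ) (sec2 hbc σ) (sec2 hmrc σ) (sec2 hmθc σ)
      (sec2 hadc σ) (haper σ) (hbper σ) (ha0 σ)
    -- `∫ t(∫mr²+mθ²) + ∫ t(∫ad²) = ∫ t(∫mr²+mθ²+ad²)`
    have j1 : IntervalIntegrable (fun t => t * ∫ θ in (0 : ℝ)..2 * π, (mr σ t θ ^ 2 + mθ σ t θ ^ 2)) volume 0 T :=
      (hHc'.comp (continuous_const.prodMk continuous_id)).intervalIntegrable _ _
    have j2 : IntervalIntegrable (fun t => t * ∫ θ in (0 : ℝ)..2 * π, ad σ t θ ^ 2) volume 0 T :=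
      (hADc'.comp (continuous_const.prodMk continuous_id)).intervalIntegrable _ _
    have h3 : (∫ t in (0 : ℝ)..T, t * ∫ θ in (0 : ℝ)..2 * π, (mr σ t θ ^ 2 + mθ σ t θ ^ 2)) +
        (∫ t in (0 : ℝ)..T, t * ∫ θ in (0 : ℝ)..2 * π, ad σ t θ ^ 2) =
        ∫ t in (0 : ℝ)..T, t * ∫ θ in (0 : ℝ)..2 * π, (mr σ t θ ^ 2 + mθ σ t θ ^ 2 + ad σ t θ ^ 2) := by
      rw [← intervalIntegral.integral_add j1 j2]
      refine intervalIntegral.integral_congr fun t _ => ?_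
      have i12 : IntervalIntegrable (fun θ => mr σ t θ ^ 2 + mθ σ t θ ^ 2) volume 0 (2 * π) :=
        (((sec1 hmrc σ t).pow 2).add ((sec1 hmθc σ t).pow 2)).intervalIntegrable _ _
      have i3 : IntervalIntegrable (fun θ => ad σ t θ ^ 2) volume 0 (2 * π) :=
        ((sec1 hadc σ t).pow 2).intervalIntegrable _ _
      show t * (∫ θ in (0 : ℝ)..2 * π, (mr σ t θ ^ 2 + mθ σ t θ ^ 2)) + t * (∫ θ in (0 : ℝ)..2 * π, ad σ t θ ^ 2) =
        t * ∫ θ in (0 : ℝ)..2 * π, (mr σ t θ ^ 2 + mθ σ t θ ^ 2 + ad σ t θ ^ 2)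
      rw [← mul_add, ← intervalIntegral.integral_add i12 i3]
    linarith
  -- ### step 2: the `β = cσ` term is the second bracket of `∂_σ W`
  have hK : ∀ σ, (∫ t in (0 : ℝ)..T, ∫ θ in (0 : ℝ)..2 * π,
      (π⁻¹ * (∫ y in (0 : ℝ)..2 * π, a σ t y * Real.cos y) * Real.cos θ +
              π⁻¹ * (∫ y in (0 : ℝ)..2 * π, a σ t y * Real.sin y) * Real.sin θ) * cσ σ t θ) =
      ∫ t in (0 : ℝ)..T, (π⁻¹ * (∫ y in (0 : ℝ)..2 * π, a σ t y * Real.cos y)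
          * (∫ y in (0 : ℝ)..2 * π, cσ σ t y * Real.cos y) + π⁻¹
          * (∫ y in (0 : ℝ)..2 * π, a σ t y * Real.sin y) * (∫ y in (0 : ℝ)..2 * π, cσ σ t y * Real.sin y)) := by
    intro σ
    refine intervalIntegral.integral_congr fun t _ => ?_
    rw [integral_firstMode_mul (sec1 hcσc σ t)]
  -- ### step 3: integrate the combined slice inequality over `σ ∈ [s₁, s₂]`
  have hLc : ContinuousOn (fun σ => ∫ t in (0 : ℝ)..T, t⁻¹ * ∫ θ in (0 : ℝ)..2 * π,
      (a σ t θ ^ 2 - b σ t θ ^ 2)) (Icc s₁ s₂) :=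
    continuousOn_intervalIntegral_inv_mul_of_bound
      (G := fun σ t => ∫ θ in (0 : ℝ)..2 * π, (a σ t θ ^ 2 - b σ t θ ^ 2)) hG hT.le hM
  have hIcc : uIcc s₁ s₂ = Icc s₁ s₂ := uIcc_of_le hs
  have hIL : IntervalIntegrable (fun σ => ∫ t in (0 : ℝ)..T, t⁻¹ * ∫ θ in (0 : ℝ)..2 * π,
      (a σ t θ ^ 2 - b σ t θ ^ 2)) volume s₁ s₂ :=
    ContinuousOn.intervalIntegrable (by rw [hIcc]; exact hLc)
  have hIA : IntervalIntegrable (fun σ => ∫ θ in (0 : ℝ)..2 * π, a σ T θ ^ 2) volume s₁ s₂ :=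
    (hA2.comp (continuous_id.prodMk continuous_const)).intervalIntegrable _ _
  have hHc : Continuous fun σ => ∫ t in (0 : ℝ)..T, t * ∫ θ in (0 : ℝ)..2 * π, (mr σ t θ ^ 2 + mθ σ t θ ^ 2) :=
    intervalIntegral.continuous_parametric_intervalIntegral_of_continuous' hHc' _ _
  have hH3c : Continuous fun σ => ∫ t in (0 : ℝ)..T, t * ∫ θ in (0 : ℝ)..2 * π,
      (mr σ t θ ^ 2 + mθ σ t θ ^ 2 + ad σ t θ ^ 2) :=
    intervalIntegral.continuous_parametric_intervalIntegral_of_continuous' hH3c' _ _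
  have hE0c : Continuous fun σ => π⁻¹ * ((∫ y in (0 : ℝ)..2 * π, a σ 0 y * Real.cos y) ^ 2
      + (∫ y in (0 : ℝ)..2 * π, a σ 0 y * Real.sin y) ^ 2) :=
    continuous_const.mul (((hCa.comp (continuous_id.prodMk continuous_const)).pow 2).add
      ((hSa.comp (continuous_id.prodMk continuous_const)).pow 2))
  have hW2c : Continuous (uncurry fun σ t => π⁻¹ * (∫ y in (0 : ℝ)..2 * π, a σ t y * Real.cos y)
      * (∫ y in (0 : ℝ)..2 * π, cσ σ t y * Real.cos y) + π⁻¹ * (∫ y in (0 : ℝ)..2 * π, a σ t y * Real.sin y)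
      * (∫ y in (0 : ℝ)..2 * π, cσ σ t y * Real.sin y)) :=
    ((continuous_const.mul hCa).mul hCcσ).add ((continuous_const.mul hSa).mul hScσ)
  have hW1c : Continuous (uncurry fun σ t => π⁻¹ * (∫ y in (0 : ℝ)..2 * π, aσ σ t y * Real.cos y)
      * (∫ y in (0 : ℝ)..2 * π, c σ t y * Real.cos y) + π⁻¹ * (∫ y in (0 : ℝ)..2 * π, aσ σ t y * Real.sin y)
      * (∫ y in (0 : ℝ)..2 * π, c σ t y * Real.sin y)) :=
    ((continuous_const.mul hCaσ).mul hCc).add ((continuous_const.mul hSaσ).mul hSc)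
  have hKc : Continuous fun σ => ∫ t in (0 : ℝ)..T, (π⁻¹ * (∫ y in (0 : ℝ)..2 * π, a σ t y * Real.cos y)
      * (∫ y in (0 : ℝ)..2 * π, cσ σ t y * Real.cos y) + π⁻¹ * (∫ y in (0 : ℝ)..2 * π, a σ t y * Real.sin y)
      * (∫ y in (0 : ℝ)..2 * π, cσ σ t y * Real.sin y)) :=
    intervalIntegral.continuous_parametric_intervalIntegral_of_continuous' hW2c _ _
  have hK1c : Continuous fun σ => ∫ t in (0 : ℝ)..T, (π⁻¹ * (∫ y in (0 : ℝ)..2 * π, aσ σ t y * Real.cos y)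
      * (∫ y in (0 : ℝ)..2 * π, c σ t y * Real.cos y) + π⁻¹ * (∫ y in (0 : ℝ)..2 * π, aσ σ t y * Real.sin y)
      * (∫ y in (0 : ℝ)..2 * π, c σ t y * Real.sin y)) :=
    intervalIntegral.continuous_parametric_intervalIntegral_of_continuous' hW1c _ _
  have hIH := hHc.intervalIntegrable (μ := volume) s₁ s₂
  have hIH3 := hH3c.intervalIntegrable (μ := volume) s₁ s₂
  have hIE0 := hE0c.intervalIntegrable (μ := volume) s₁ s₂
  have hIK : IntervalIntegrable (fun σ => 2 * ∫ t in (0 : ℝ)..T, (π⁻¹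
      * (∫ y in (0 : ℝ)..2 * π, a σ t y * Real.cos y) * (∫ y in (0 : ℝ)..2 * π, cσ σ t y * Real.cos y) + π⁻¹
      * (∫ y in (0 : ℝ)..2 * π, a σ t y * Real.sin y)
      * (∫ y in (0 : ℝ)..2 * π, cσ σ t y * Real.sin y))) volume s₁ s₂ :=
    (continuous_const.mul hKc).intervalIntegrable s₁ s₂
  have hmono := intervalIntegral.integral_mono_on hs (hIL.add hIA) (((hIH.add hIH3).add hIE0).sub hIK) fun σ hσ => by
    have h := hslice σ hσ
    rw [hK σ] at h
    exact h
  rw [intervalIntegral.integral_add hIL hIA, intervalIntegral.integral_sub ((hIH.add hIH3).add hIE0) hIK,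
    intervalIntegral.integral_add (hIH.add hIH3) hIE0, intervalIntegral.integral_add hIH hIH3,
    intervalIntegral.integral_const_mul (2 : ℝ)] at hmono
  -- ### step 5: the `β`-term by parts in `σ`
  have hftc := pairing_sigma_ftc haσ hcσ hac hcc haσc hcσc s₁ s₂ T
  have hsplitK : (∫ σ in s₁..s₂, ∫ t in (0 : ℝ)..T,
      ((π⁻¹ * (∫ y in (0 : ℝ)..2 * π, aσ σ t y * Real.cos y) * (∫ y in (0 : ℝ)..2 * π, c σ t y * Real.cos y)
          + π⁻¹ * (∫ y in (0 : ℝ)..2 * π, aσ σ t y * Real.sin y) * (∫ y in (0 : ℝ)..2 * π, c σ t y * Real.sin y)) +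
        (π⁻¹ * (∫ y in (0 : ℝ)..2 * π, a σ t y * Real.cos y) * (∫ y in (0 : ℝ)..2 * π, cσ σ t y * Real.cos y)
            + π⁻¹ * (∫ y in (0 : ℝ)..2 * π, a σ t y * Real.sin y)
            * (∫ y in (0 : ℝ)..2 * π, cσ σ t y * Real.sin y)))) =
      (∫ σ in s₁..s₂, ∫ t in (0 : ℝ)..T, (π⁻¹ * (∫ y in (0 : ℝ)..2 * π, aσ σ t y * Real.cos y)
          * (∫ y in (0 : ℝ)..2 * π, c σ t y * Real.cos y) + π⁻¹
          * (∫ y in (0 : ℝ)..2 * π, aσ σ t y * Real.sin y) * (∫ y in (0 : ℝ)..2 * π, c σ t y * Real.sin y))) +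
        ∫ σ in s₁..s₂, ∫ t in (0 : ℝ)..T, (π⁻¹ * (∫ y in (0 : ℝ)..2 * π, a σ t y * Real.cos y)
            * (∫ y in (0 : ℝ)..2 * π, cσ σ t y * Real.cos y) + π⁻¹
            * (∫ y in (0 : ℝ)..2 * π, a σ t y * Real.sin y) * (∫ y in (0 : ℝ)..2 * π, cσ σ t y * Real.sin y)) := by
    rw [← intervalIntegral.integral_add (hK1c.intervalIntegrable _ _) (hKc.intervalIntegrable _ _)]
    refine intervalIntegral.integral_congr fun σ _ => ?_
    exact intervalIntegral.integral_add
      ((hW1c.comp (continuous_const.prodMk continuous_id)).intervalIntegrable _ _)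
      ((hW2c.comp (continuous_const.prodMk continuous_id)).intervalIntegrable _ _)
  -- ### step 6: the cross term `2∫∫ (first bracket) ≤ ∫∫ t(∫aσ² + ∫mz²)`
  have hXc : Continuous (uncurry fun σ t => t * ((∫ θ in (0 : ℝ)..2 * π, aσ σ t θ ^ 2) +
      ∫ θ in (0 : ℝ)..2 * π, mz σ t θ ^ 2)) := continuous_snd.mul (hX1.add hX2)
  have hIX := (intervalIntegral.continuous_parametric_intervalIntegral_of_continuous' (μ := volume) hXc 0 T).intervalIntegrable
    (μ := volume) s₁ s₂
  have hcross : 2 * (∫ σ in s₁..s₂, ∫ t in (0 : ℝ)..T, (π⁻¹ * (∫ y in (0 : ℝ)..2 * π, aσ σ t y * Real.cos y)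
      * (∫ y in (0 : ℝ)..2 * π, c σ t y * Real.cos y) + π⁻¹ * (∫ y in (0 : ℝ)..2 * π, aσ σ t y * Real.sin y)
      * (∫ y in (0 : ℝ)..2 * π, c σ t y * Real.sin y))) ≤
      ∫ σ in s₁..s₂, ∫ t in (0 : ℝ)..T, t * ((∫ θ in (0 : ℝ)..2 * π, aσ σ t θ ^ 2) +
        ∫ θ in (0 : ℝ)..2 * π, mz σ t θ ^ 2) := by
    rw [← intervalIntegral.integral_const_mul (2 : ℝ)]
    refine intervalIntegral.integral_mono_on hs ((continuous_const.mul hK1c).intervalIntegrable _ _) hIX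
      fun σ _ => ?_
    rw [← intervalIntegral.integral_const_mul (2 : ℝ)]
    refine intervalIntegral.integral_mono_on hT.le
      ((continuous_const.mul (hW1c.comp (continuous_const.prodMk continuous_id))).intervalIntegrable _ _)
      ((hXc.comp (continuous_const.prodMk continuous_id)).intervalIntegrable _ _) fun t ht => ?_
    have h := two_mul_abs_pairing_deriv_le (sec1 haσc σ t) (hcθ σ t) (sec1 hmzc σ t) (hcper σ t) ht.1
    linarith [h, le_abs_self (π⁻¹ * (∫ y in (0 : ℝ)..2 * π, aσ σ t y * Real.cos y)
        * (∫ y in (0 : ℝ)..2 * π, c σ t y * Real.cos y) + π⁻¹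
        * (∫ y in (0 : ℝ)..2 * π, aσ σ t y * Real.sin y) * (∫ y in (0 : ℝ)..2 * π, c σ t y * Real.sin y))]
  -- ### step 7: the end discs `2|U(s)| ≤ B(s)`
  have hend : ∀ s, 2 * |∫ t in (0 : ℝ)..T, (π⁻¹ * (∫ y in (0 : ℝ)..2 * π, a s t y * Real.cos y)
      * (∫ y in (0 : ℝ)..2 * π, c s t y * Real.cos y) + π⁻¹ * (∫ y in (0 : ℝ)..2 * π, a s t y * Real.sin y)
      * (∫ y in (0 : ℝ)..2 * π, c s t y * Real.sin y))| ≤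
      (∫ t in (0 : ℝ)..T, ∫ θ in (0 : ℝ)..2 * π, (a s t θ ^ 2 + c s t θ ^ 2)) := by
    intro s
    have hb := intervalIntegral.norm_integral_le_of_norm_le (μ := volume) (a := 0) (b := T)
      (f := fun t => 2 * (π⁻¹ * (∫ y in (0 : ℝ)..2 * π, a s t y * Real.cos y)
          * (∫ y in (0 : ℝ)..2 * π, c s t y * Real.cos y) + π⁻¹
          * (∫ y in (0 : ℝ)..2 * π, a s t y * Real.sin y) * (∫ y in (0 : ℝ)..2 * π, c s t y * Real.sin y)))
      (g := fun t => ∫ θ in (0 : ℝ)..2 * π, (a s t θ ^ 2 + c s t θ ^ 2)) hT.le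
      (Eventually.of_forall fun t _ => by
        rw [Real.norm_eq_abs, abs_mul, abs_two]
        have i1 : IntervalIntegrable (fun θ => a s t θ ^ 2) volume 0 (2 * π) :=
          ((sec1 hac s t).pow 2).intervalIntegrable _ _
        have i2 : IntervalIntegrable (fun θ => c s t θ ^ 2) volume 0 (2 * π) :=
          ((sec1 hcc s t).pow 2).intervalIntegrable _ _
        have h := two_mul_abs_pairing_le (sec1 hac s t) (sec1 hcc s t)
        rw [← intervalIntegral.integral_add i1 i2] at h
        exact h)
      ((hAC.comp (continuous_const.prodMk continuous_id)).intervalIntegrable _ _)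
    rw [Real.norm_eq_abs, intervalIntegral.integral_const_mul (2 : ℝ), abs_mul, abs_two] at hb
    exact hb
  have hend₁ := hend s₁
  have hend₂ := hend s₂
  -- ### step 8: recombine the Frobenius pieces of the hoop side
  have hsum : (∫ σ in s₁..s₂, ∫ t in (0 : ℝ)..T, t * ∫ θ in (0 : ℝ)..2 * π, (mr σ t θ ^ 2 + mθ σ t θ ^ 2)) +
      (∫ σ in s₁..s₂, ∫ t in (0 : ℝ)..T, t * ((∫ θ in (0 : ℝ)..2 * π, aσ σ t θ ^ 2) +
        ∫ θ in (0 : ℝ)..2 * π, mz σ t θ ^ 2)) =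
      ∫ σ in s₁..s₂, ∫ t in (0 : ℝ)..T, t * ∫ θ in (0 : ℝ)..2 * π,
          (mr σ t θ ^ 2 + mθ σ t θ ^ 2 + aσ σ t θ ^ 2 + mz σ t θ ^ 2) := by
    rw [← intervalIntegral.integral_add hIH hIX]
    refine intervalIntegral.integral_congr fun σ _ => ?_
    have j1 : IntervalIntegrable (fun t => t * ∫ θ in (0 : ℝ)..2 * π, (mr σ t θ ^ 2 + mθ σ t θ ^ 2)) volume 0 T :=
      (hHc'.comp (continuous_const.prodMk continuous_id)).intervalIntegrable _ _
    have j2 : IntervalIntegrable (fun t => t * ((∫ θ in (0 : ℝ)..2 * π, aσ σ t θ ^ 2) +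
        ∫ θ in (0 : ℝ)..2 * π, mz σ t θ ^ 2)) volume 0 T :=
      (hXc.comp (continuous_const.prodMk continuous_id)).intervalIntegrable _ _
    show (∫ t in (0 : ℝ)..T, t * ∫ θ in (0 : ℝ)..2 * π, (mr σ t θ ^ 2 + mθ σ t θ ^ 2)) +
        (∫ t in (0 : ℝ)..T, t * ((∫ θ in (0 : ℝ)..2 * π, aσ σ t θ ^ 2) + ∫ θ in (0 : ℝ)..2 * π, mz σ t θ ^ 2)) =
      ∫ t in (0 : ℝ)..T, t * ∫ θ in (0 : ℝ)..2 * π, (mr σ t θ ^ 2 + mθ σ t θ ^ 2 + aσ σ t θ ^ 2 + mz σ t θ ^ 2)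
    rw [← intervalIntegral.integral_add j1 j2]
    refine intervalIntegral.integral_congr fun t _ => ?_
    have i12 : IntervalIntegrable (fun θ => mr σ t θ ^ 2 + mθ σ t θ ^ 2) volume 0 (2 * π) :=
      (((sec1 hmrc σ t).pow 2).add ((sec1 hmθc σ t).pow 2)).intervalIntegrable _ _
    have i3 : IntervalIntegrable (fun θ => aσ σ t θ ^ 2) volume 0 (2 * π) :=
      ((sec1 haσc σ t).pow 2).intervalIntegrable _ _
    have i4 : IntervalIntegrable (fun θ => mz σ t θ ^ 2) volume 0 (2 * π) :=
      ((sec1 hmzc σ t).pow 2).intervalIntegrable _ _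
    have e : ∫ θ in (0 : ℝ)..2 * π, (mr σ t θ ^ 2 + mθ σ t θ ^ 2 + aσ σ t θ ^ 2 + mz σ t θ ^ 2) =
        (∫ θ in (0 : ℝ)..2 * π, (mr σ t θ ^ 2 + mθ σ t θ ^ 2)) +
          ((∫ θ in (0 : ℝ)..2 * π, aσ σ t θ ^ 2) + ∫ θ in (0 : ℝ)..2 * π, mz σ t θ ^ 2) := by
      rw [← intervalIntegral.integral_add i3 i4, ← intervalIntegral.integral_add i12 (i3.add i4)]
      exact intervalIntegral.integral_congr fun θ _ => by ring
    show t * (∫ θ in (0 : ℝ)..2 * π, (mr σ t θ ^ 2 + mθ σ t θ ^ 2)) +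
        t * ((∫ θ in (0 : ℝ)..2 * π, aσ σ t θ ^ 2) + ∫ θ in (0 : ℝ)..2 * π, mz σ t θ ^ 2) =
      t * ∫ θ in (0 : ℝ)..2 * π, (mr σ t θ ^ 2 + mθ σ t θ ^ 2 + aσ σ t θ ^ 2 + mz σ t θ ^ 2)
    rw [e]
    ring
  -- ### conclusion
  have habs₁ := le_abs_self (∫ t in (0 : ℝ)..T, (π⁻¹ * (∫ y in (0 : ℝ)..2 * π, a s₁ t y * Real.cos y)
      * (∫ y in (0 : ℝ)..2 * π, c s₁ t y * Real.cos y) + π⁻¹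
      * (∫ y in (0 : ℝ)..2 * π, a s₁ t y * Real.sin y) * (∫ y in (0 : ℝ)..2 * π, c s₁ t y * Real.sin y)))
  have habs₂ := neg_abs_le (∫ t in (0 : ℝ)..T, (π⁻¹ * (∫ y in (0 : ℝ)..2 * π, a s₂ t y * Real.cos y)
      * (∫ y in (0 : ℝ)..2 * π, c s₂ t y * Real.cos y) + π⁻¹
      * (∫ y in (0 : ℝ)..2 * π, a s₂ t y * Real.sin y) * (∫ y in (0 : ℝ)..2 * π, c s₂ t y * Real.sin y)))
  linarith [hmono, hftc, hsplitK, hcross, hend₁, hend₂, hsum, habs₁, habs₂]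

end Summit.NavierStokesRegularity.NavierStokesRegularity.Theorems.PowerGaugeEulerLiouville.HoopCore

end
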